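import Mathlib
import HarnessLib
import Summits.ValiantsHypothesis.ValiantsHypothesis.Theorems.MonotoneRestorationMonotoneRestorationQPLinearWidthDefs

/-!
# Route MonotoneRestoration, crux `MonotoneRestorationQP` (stmt-15886), line `linear-width`, GAP 1 `stub_degreeLifting` —
# NO INDIVIDUALISING MULTIPLIER SURVIVES A GLUED INDISTINGUISHABLE PENCIL (helper, def-free)

Context.  The width hypothesis of `WidthRung d` saturates: for the saturator `D = Disc(row sums)²·Disc(col sums)²` and
EVERY matrix-symmetric `h`, `D·h` is polylog-hom-determined (`…LinearWidthSaturation.lean`), so `WidthRestorationQP`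
restores `D·h`; getting back to `h` by exact division in orbit currency (`ValueOrbitDivision.qpOrbitRestorable_of_mul_eq_of_eval_ne_zero`,
item 18293) needs a base point `a` FIXED by the diagonal `Sym(Fin n)` with `D(a) ≠ 0`, and THIS saturator vanishes at every
such point (`…LinearWidthInvariantLocus.lean`, `…LinearWidthSaturatorVanishes.lean`).  Could a cleverer multiplier `D'`
(any polynomial such that `D'` and `D'·h` are hom-determined for the `h` at hand) be non-zero at an invariant point?

This file answers NO in the only way the question can be settled inside the kernel today — relative to ONE glued
indistinguishable pencil — and for an ARBITRARY indistinguishability relation `Ind` on points of `ℂ^{n×n}` (so it applies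
verbatim to the line's `HomIndist n k`, to `C^k`-equivalence of weighted structures, or to any future currency):

* `eval_linePoly` — evaluation along the pencil `t ↦ a + t·N` is a one-variable polynomial (bookkeeping);
* `eval_eq_zero_of_determined_pencil` — **THE NO-GO.**  If the two pencils `a + t·N₁`, `a + t·N₂` through `a` are
  `Ind`-indistinguishable for every `t`, `D` and `D·h` are `Ind`-determined, and `h` separates the pencils at ONE
  parameter `t₀`, then `D(a) = 0`.  (Along the pencils `D(a+tN₁)·(h(a+tN₁) − h(a+tN₂)) = 0`; the second factor is a
  non-zero polynomial in `t`, so the first vanishes identically, in particular at `t = 0`.)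
* `eval_eq_zero_of_homDetermined_pencil` — the instance `Ind = HomIndist n k` (line vocabulary,
  `…LinearWidthDefs.lean`): a multiplier making `h` hom-determined below treewidth `k` vanishes at every base point
  carrying a glued `k`-indistinguishable pencil separated by `h`.

Where the pencils come from (informal, not used here): for `a = α·I + β·(J − I)` and adjacency matrices `N₁, N₂` of
`C^{k'}`-equivalent graphs, the glued points `a + t·N_i` are two-sorted hom-indistinguishable below treewidth `≈ k'/2`
(the marked diagonal identifies rows with columns; pattern quotients at most double the bag size), while a
matrix-symmetric `VP` family violating `HomDeterminedVP` would separate such a pencil — so on the locus where GAP 1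
has content, no multiplier-and-divide strategy exists at ANY invariant base point, not only for the Vandermonde
saturator.  Honest label: a no-go lemma for one proof template of a registered stub; nothing closed; VP ≠ VNP untouched.
[folklore; cite: Strassen1973 (division elimination needs a unit at the base point)]
-/

-- `Summit.ValiantsHypothesis.ValiantsHypothesis.…` is the tree's mandated namespace (Sub = Summit).
set_option linter.dupNamespace false

noncomputable section

namespace Summit.ValiantsHypothesis.ValiantsHypothesis.Theorems

namespace MultiplierNoGo

open MvPolynomial

variable {n : ℕ}

/-- **Evaluation along a pencil is a one-variable polynomial**: substituting `x ↦ a_x + N_x · t` into `q` and then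
`t ↦ t₀` is evaluating `q` at the point `a + t₀·N`. [folklore] -/
theorem eval_linePoly (a N : Fin n × Fin n → ℂ) (q : MvPolynomial (Fin n × Fin n) ℂ) (t : ℂ) :
    Polynomial.eval t (aeval (fun x : Fin n × Fin n => Polynomial.C (a x) + Polynomial.C (N x) * Polynomial.X) q) =
      eval (fun x => a x + t * N x) q := by
  induction q using MvPolynomial.induction_on with
  | C c => simp only [algHom_C, Polynomial.algebraMap_eq, Polynomial.eval_C, eval_C]
  | add p q hp hq => simp only [map_add, Polynomial.eval_add, hp, hq]
  | mul_X p i hp =>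
      simp only [map_mul, Polynomial.eval_mul, hp, aeval_X, Polynomial.eval_add, Polynomial.eval_C,
        Polynomial.eval_X, eval_X]
      ring

/-- **THE NO-GO FOR INDIVIDUALISING MULTIPLIERS.**  Let `Ind` be any relation on points of `ℂ^{n×n}`
("indistinguishable"), `a` a base point and `N₁, N₂` two directions such that the pencils `a + t·N₁` and `a + t·N₂` are
`Ind`-related for every `t`.  If `D` and `D·h` are `Ind`-determined (equal values at `Ind`-related points) and `h` takes
different values on the two pencils at some parameter `t₀`, then `D(a) = 0`. [folklore] -/
theorem eval_eq_zero_of_determined_pencil (Ind : (Fin n × Fin n → ℂ) → (Fin n × Fin n → ℂ) → Prop)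
    (a N₁ N₂ : Fin n × Fin n → ℂ)
    (hInd : ∀ t : ℂ, Ind (fun x => a x + t * N₁ x) (fun x => a x + t * N₂ x))
    {D h : MvPolynomial (Fin n × Fin n) ℂ}
    (hD : ∀ A B, Ind A B → eval A D = eval B D)
    (hDh : ∀ A B, Ind A B → eval A (D * h) = eval B (D * h))
    (hsep : ∃ t₀ : ℂ, eval (fun x => a x + t₀ * N₁ x) h ≠ eval (fun x => a x + t₀ * N₂ x) h) :
    eval a D = 0 := by
  -- the one-variable polynomials along the two pencils
  set φ₁ : MvPolynomial (Fin n × Fin n) ℂ →ₐ[ℂ] Polynomial ℂ :=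
    aeval fun x : Fin n × Fin n => Polynomial.C (a x) + Polynomial.C (N₁ x) * Polynomial.X with hφ₁
  set φ₂ : MvPolynomial (Fin n × Fin n) ℂ →ₐ[ℂ] Polynomial ℂ :=
    aeval fun x : Fin n × Fin n => Polynomial.C (a x) + Polynomial.C (N₂ x) * Polynomial.X with hφ₂
  set d : Polynomial ℂ := φ₁ D with hd
  set δ : Polynomial ℂ := φ₁ h - φ₂ h with hδ
  -- `d · δ` vanishes everywhere, hence is the zero polynomial
  have hprod : d * δ = 0 := by
    apply Polynomial.funext
    intro t
    have h1 : eval (fun x => a x + t * N₁ x) D * eval (fun x => a x + t * N₁ x) h =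
        eval (fun x => a x + t * N₂ x) D * eval (fun x => a x + t * N₂ x) h := by
      simpa only [map_mul] using hDh _ _ (hInd t)
    have h2 : eval (fun x => a x + t * N₁ x) D = eval (fun x => a x + t * N₂ x) D := hD _ _ (hInd t)
    simp only [hd, hδ, hφ₁, hφ₂, Polynomial.eval_mul, Polynomial.eval_sub, Polynomial.eval_zero, eval_linePoly]
    rw [mul_sub, h1, h2, sub_self]
  -- `δ ≠ 0` since `h` separates the pencils at `t₀`
  have hδ0 : δ ≠ 0 := by
    obtain ⟨t₀, ht₀⟩ := hsep
    intro h0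
    apply ht₀
    have := congrArg (Polynomial.eval t₀) h0
    simp only [hδ, hφ₁, hφ₂, Polynomial.eval_sub, eval_linePoly, Polynomial.eval_zero, sub_eq_zero] at this
    exact this
  -- hence `d = 0`, and its value at `t = 0` is `D(a)`
  have hd0 : d = 0 := (mul_eq_zero.1 hprod).resolve_right hδ0
  have := congrArg (Polynomial.eval (0 : ℂ)) hd0
  simp only [hd, hφ₁, eval_linePoly, Polynomial.eval_zero, zero_mul, add_zero] at this
  exact this

open MonotoneRestorationQPLinearWidth in
/-- **Instance: hom-indistinguishability below treewidth `k`** (the line's `HomIndist n k`).  If the glued pencils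
`a + t·N₁`, `a + t·N₂` are hom-indistinguishable below treewidth `k` for every `t` and some polynomial `h` separates them
at one parameter, then every multiplier `D` for which both `D` and `D·h` are hom-determined below treewidth `k` (equal
values at `HomIndist n k`-related points) vanishes at the base point `a`: Strassen division at `a` is unavailable for it.
[folklore] -/
theorem eval_eq_zero_of_homDetermined_pencil {k : ℕ} (a N₁ N₂ : Fin n × Fin n → ℂ)
    (hInd : ∀ t : ℂ, HomIndist n k (fun x => a x + t * N₁ x) (fun x => a x + t * N₂ x))
    {D h : MvPolynomial (Fin n × Fin n) ℂ}
    (hD : ∀ A B, HomIndist n k A B → eval A D = eval B D)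
    (hDh : ∀ A B, HomIndist n k A B → eval A (D * h) = eval B (D * h))
    (hsep : ∃ t₀ : ℂ, eval (fun x => a x + t₀ * N₁ x) h ≠ eval (fun x => a x + t₀ * N₂ x) h) :
    eval a D = 0 :=
  eval_eq_zero_of_determined_pencil (HomIndist n k) a N₁ N₂ hInd hD hDh hsep

/-- **Contrapositive, the form a prover meets**: if `D(a) ≠ 0` at a base point through which an `Ind`-indistinguishable
glued pencil pair passes, and `D`, `D·h` are `Ind`-determined, then `h` does NOT separate the pencils — the multiplier
can only individualise where `h` had nothing to distinguish. [folklore] -/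
theorem not_separating_of_eval_ne_zero (Ind : (Fin n × Fin n → ℂ) → (Fin n × Fin n → ℂ) → Prop)
    (a N₁ N₂ : Fin n × Fin n → ℂ)
    (hInd : ∀ t : ℂ, Ind (fun x => a x + t * N₁ x) (fun x => a x + t * N₂ x))
    {D h : MvPolynomial (Fin n × Fin n) ℂ}
    (hD : ∀ A B, Ind A B → eval A D = eval B D)
    (hDh : ∀ A B, Ind A B → eval A (D * h) = eval B (D * h)) (hDa : eval a D ≠ 0) (t : ℂ) :
    eval (fun x => a x + t * N₁ x) h = eval (fun x => a x + t * N₂ x) h := by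
  by_contra hne
  exact hDa (eval_eq_zero_of_determined_pencil Ind a N₁ N₂ hInd hD hDh ⟨t, hne⟩)

end MultiplierNoGo

end Summit.ValiantsHypothesis.ValiantsHypothesis.Theorems

end
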